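/-
Copyright (c) 2026 the pub-hodgecm-mathlib formalisation cell (harness21).  Prover seat hodgecm-mathlib-K2E1-p14 (g3), Track B ∕ K2-LIT, h413 = `stmt-HodgeConjecture-24833`,
R90-TF section S8 «ContSpec-n½», socket #2 ∕ (E) road at N = 3 (S8 dealer R90-CS-plan (g2) S8-R109 (3)): the letter (L₃) of ★ F1_qs p862541 — the atoms `At i b` of a `(χ₁, χ₂)`-block
lie in `(⨆_ψ ℂ·[ψ∘det]) ⊔ ⨆_ξ resGMidBlock ξ` — REDUCED to its per-atom letters (TOP-pole residue classes are character classes; MIDDLE-pole residue classes are middle atoms of some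
`ξ`) and the model letter, at the ★ G-DEFS atoms `resGAtom` and at K2E1-p11's ★ K-type atoms `resGAtomK`; the N = 3 twin of K2E2-p12's ★ p862513 `R90S8ResHResiduesAreCharLinesU2`.
-/
import Summits.HodgeConjecture.HodgeConjecture.Theorems.R90S8ResGKTypeBlockU3Defs             -- ★ p862819 (K2E1-p11): `resGAtomK Iso U Kf χ₁ χ₂ := resGAtom U (Kf.map ι_f) 1 χ₁ χ₂ ⊓ Iso`, `resGAtomK_le_resGAtom`; brings ★ G-DEFS `resGBlock ∕ resGAtom` (`R90S8ResGBlockDataU3Defs`)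
import Summits.HodgeConjecture.HodgeConjecture.Theorems.R90S8ResGMidAtomU3Defs                -- ★ (K2E1-p11): `resGMidAtomGen ∕ resGMidAtom ξ μω K' ω`, `resGMidBlock ξ μω`, `resGMidAtom_le_resGMidBlock`, `mem_resGMidAtom_of_mem_gen`
import Summits.HodgeConjecture.HodgeConjecture.Theorems.K2E1ChiEisensteinTopResidueCharLineU3  -- ★ F6 (K2E1-p13): `mem_iSup_lineSubrep_cmDetChar_three_of_ae_eq{,_residue}` (an `L²` class a.e. `r·Θ((out x)⁻¹)` lies in `⨆_ψ ℂ·[ψ∘det]`); brings ★ `cmDetChar`, ★ `lineSubrep`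
import Summits.HodgeConjecture.HodgeConjecture.Theorems.R90S8ResHResiduesAreCharLinesU2        -- ★ p862513 (K2E2-p12): §1 abstract `inf_ker_snd_le_of_atoms_mem` (EVERY module; the N = 2 twin this file follows)
import HarnessLib

/-!
# S8 #2 ∕ (E) road at N = 3, letter (L₃) — `R90S8ResGAtomsLeLinesSupMidBlocksU3`: `At ≤ (⨆_ψ ℂ·[ψ∘det]) ⊔ ⨆_ξ resGMidBlock ξ` for the atoms of a `(χ₁, χ₂)`-block of `L²(U(J₃)_{L∕L⁺})`,
# from the MODEL letter and the per-atom letters (TOP-pole residue classes ∈ character lines — membership, a.e. and pointwise-residue forms, paid in shape by ★ F6; MIDDLE-pole residue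
# classes ∈ some middle atom `resGMidAtom ξ μω K″ ω″` — by definition inside the hull `resGMidBlock ξ μω`), at ★ `resGAtom` and at the ★ K-type atoms `resGAtomK` of record

Track B ∕ K2-LIT, crux h413 = `stmt-HodgeConjecture-24833`, route of record `HCCMUnconditional`; cell `hodgecm-mathlib`, R90-TF programme, section S8 «ContSpec-n½», socket #2's ED. 5
sub-socket (E) `sock_S8_res_exhaustion_le_closure` (S8-R68): ★ F1_qs `residualG_le_topologicalClosure_of_letters_quasiSplit`'s binder
`hL : ∀ i b, At i b ≤ (⨆_ψ (lineSubrep (cmDetChar L 3 J₃ ψ …) μ).toSubmodule) ⊔ ⨆_k (Bn k).toSubmodule` at `Bn := fun ξ => resGMidBlock L μ ξ μω` and the K-type atoms of record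
`At i b := resGAtomK L μ (N i) (U i b) i.1.1 (χ₁ b) (χ₂ b)` (KTYPE-ASSEMBLY memo of record 92c095b3c5a1c471).  THEOREMS ONLY (no `def`, no `instance`, no `notation`, no named-fact
hypothesis, no `sorry`; default heartbeats); lane `--supports stmt-HodgeConjecture-24833 --as helper` (count-neutral).  CLOSES NO SOCKET: (L₃) is REDUCED to VISIBLE letters per block —
the model letter `hatom` and the per-atom letters `heTop`, `heMid` — exactly as K2E2-p12's ★ `R90S8ResHResiduesAreCharLinesU2` reduced (L) at N = 2 (there: one pole, one family).

THE MATHEMATICS ([Rogawski1990, §13.9 p. 229 (i)–(ii)]; [MoeglinWaldspurger1995, IV.1.11, V.3.13, VI.2]).  The residual atoms of the `(χ₁, χ₂)`-block of the Borel Eisenstein series on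
`U(2,1)` are spanned by the residues at the TOP pole (`z = 2`: multiples `r·(ψ∘det)` of automorphic characters — the character lines `ℂ·[ψ∘det]`, case (i); ★ F6's currency
`⇑f =ᵐ x ↦ r·Θ((out x)⁻¹)`) and at the MIDDLE pole (`z = 3/2`: the generators ★ `resGMidAtomGen ξ μω K″ ω″` of the `πⁿ(ξ)`-blocks, case (ii)).  In the three-slot block model
`U : L² →ₗ (A × M) × Λ` (★ G-DEFS) the atoms are `At = Sc ⊓ ker(snd ∘ U)`; the MODEL letter says every such vector is a finite combination of top residue classes `eTop k` and middle
residue classes `eMid k`; `eTop k ∈ ⨆_ψ ℂ·[ψ∘det]` is ★ F6 `mem_iSup_lineSubrep_cmDetChar_three_of_ae_eq` (from the a.e. letter) and `eMid k ∈ resGMidAtom L μ ξ μω K″ ω″` (from the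
generator letter, ★ `mem_resGMidAtom_of_mem_gen`) lies in `Bn ξ = resGMidBlock ξ μω` (★ `resGMidAtom_le_resGMidBlock`: the hull contains every level's middle atoms BY DEFINITION, so the
middle letter may sit at ANY level `(K″, ω″)`).  The K-type atoms `resGAtomK = resGAtom ⊓ Iso` follow by ★ `resGAtomK_le_resGAtom` (`Iso` plays no role).
* §1 `inf_ker_snd_le_sup_of_atoms_mem` (abstract, two families), `inf_ker_snd_le_sup_of_atoms_mem_or` (one family, each class top OR middle; ★ `inf_ker_snd_le_of_atoms_mem`).
* §2 on the carrier `quasiSplit L⁺ L c 3`, any `Sc`: `inf_ker_snd_le_lines_sup_midBlocks_of_mem ∕ _of_ae_eq ∕ _of_residue`.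
* §3 BY NAME: **`resGAtom_le_lines_sup_midBlocks_of_mem ∕ _of_ae_eq ∕ _of_residue`** (any level datum `(K′, ω)`), **`resGAtomK_le_lines_sup_midBlocks_of_mem ∕ _of_ae_eq`** (K-type atoms).
* §4 **`hL_kType_of_atoms_mem`**, **`hL_kType_of_atoms`** — ★ F1_qs's `hL` binder shape over ANY index family `(i, b) ↦ (Iso i, Kf i, U i b, χ₁ i b, χ₂ i b)` at `Bn := fun ξ => resGMidBlock L μ ξ μω`.
HONEST LABEL: HC_CM is proved only modulo the 7 printed citations (2 remaining named inputs: hLiu418 = `stmt-HodgeConjecture-24832`, h413 = `stmt-HodgeConjecture-24833`) until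
rung 0 closes; REL ≠ ★ ≠ BUILT; this file asserts no named fact and closes no socket ((L₃)'s content — top residues are `r·Θ`, middle residues are middle generators, atoms are
spanned by residues — stays in the visible letters `hatom heTop heMid`); count-neutral.

## References
* [Rogawski1990] J. D. Rogawski, *Automorphic Representations of Unitary Groups in Three Variables* (1990), §13.9 p. 229 (i)–(ii), §13.3 p. 202, §12.2 (3) p. 173.
* [MoeglinWaldspurger1995] C. Mœglin, J.-L. Waldspurger, *Spectral Decomposition and Eisenstein Series* (1995), IV.1.11, V.3.13, VI.2.
-/

set_option autoImplicit false
set_option linter.dupNamespace false  -- the mandated namespace `…HodgeConjecture.HodgeConjecture.R90.S8` (LEAD #1 L1) repeats the summit's segment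

noncomputable section

open MeasureTheory Measure Set Filter Topology NumberField
open Literature.NumberTheory.Automorphic Literature.NumberTheory.Automorphic.UnitaryGroup Literature.NumberTheory.GaloisRepresentations AdelicGroupData
open Literature.NumberTheory.Automorphic.Arthur2013.Leaves.TECR Literature.NumberTheory.Rogawski1990
open Summit.HodgeConjecture.HodgeConjecture.Cruxes.H413.K2E1ChiEisensteinTopResidueCharLineU3 (mem_iSup_lineSubrep_cmDetChar_three_of_ae_eq mem_iSup_lineSubrep_cmDetChar_three_of_ae_eq_residue)
open ContRepresentation
open scoped ENNReal NNReal

namespace Summit.HodgeConjecture.HodgeConjecture.R90.S8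

/-! ## §1 Abstract: atoms spanned by two residue families lie in `T₁ ⊔ T₂` -/

section Model

variable {H : Type*} [AddCommGroup H] [Module ℂ H] {A M Λ : Type*} [AddCommGroup A] [Module ℂ A] [AddCommGroup M] [Module ℂ M] [AddCommGroup Λ] [Module ℂ Λ]

/-- **THE MODEL LETTER WITH TWO RESIDUE FAMILIES**: if every pure-atom vector of `Sc` (line coordinate `(U v).2 = 0` in the three-slot model `U : H →ₗ (A × M) × Λ`) lies in
`span (range eTop) ⊔ span (range eMid)`, and `eTop k ∈ T₁`, `eMid k ∈ T₂`, then `Sc ⊓ ker (snd ∘ U) ≤ T₁ ⊔ T₂`. [cite: MoeglinWaldspurger1995, V.3.13, VI.2] -/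
theorem inf_ker_snd_le_sup_of_atoms_mem (U : H →ₗ[ℂ] (A × M) × Λ) (Sc : Submodule ℂ H) {ιt ιm : Type*} (eTop : ιt → H) (eMid : ιm → H)
    (hatom : ∀ v ∈ Sc, (U v).2 = 0 → v ∈ Submodule.span ℂ (Set.range eTop) ⊔ Submodule.span ℂ (Set.range eMid))
    (T₁ T₂ : Submodule ℂ H) (heTop : ∀ k, eTop k ∈ T₁) (heMid : ∀ k, eMid k ∈ T₂) :
    Sc ⊓ LinearMap.ker ((LinearMap.snd ℂ (A × M) Λ).comp U) ≤ T₁ ⊔ T₂ := fun v hv =>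
  (sup_le_sup (Submodule.span_le.2 (Set.range_subset_iff.2 heTop)) (Submodule.span_le.2 (Set.range_subset_iff.2 heMid)))
    (hatom v (Submodule.mem_inf.1 hv).1 (LinearMap.mem_ker.1 (Submodule.mem_inf.1 hv).2))

/-- **ONE-FAMILY VARIANT** (each residue class is a top one or a middle one): if the pure-atom vectors lie in `span (range e)` and every `e k` lies in `T₁` or in `T₂`, then
`Sc ⊓ ker (snd ∘ U) ≤ T₁ ⊔ T₂` (★ `inf_ker_snd_le_of_atoms_mem`). [cite: MoeglinWaldspurger1995, V.3.13, VI.2] -/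
theorem inf_ker_snd_le_sup_of_atoms_mem_or (U : H →ₗ[ℂ] (A × M) × Λ) (Sc : Submodule ℂ H) {ιa : Type*} (e : ιa → H)
    (hatom : ∀ v ∈ Sc, (U v).2 = 0 → v ∈ Submodule.span ℂ (Set.range e))
    (T₁ T₂ : Submodule ℂ H) (he : ∀ k, e k ∈ T₁ ∨ e k ∈ T₂) :
    Sc ⊓ LinearMap.ker ((LinearMap.snd ℂ (A × M) Λ).comp U) ≤ T₁ ⊔ T₂ :=
  inf_ker_snd_le_of_atoms_mem U Sc e hatom (T₁ ⊔ T₂) fun k => (he k).elim (fun h => Submodule.mem_sup_left h) fun h => Submodule.mem_sup_right h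

end Model

/-! ## §2 On the carrier `U(J₃) = quasiSplit L⁺ L c 3`, any block `Sc`: the target `(⨆_ψ ℂ·[ψ∘det]) ⊔ ⨆_ξ resGMidBlock ξ μω` -/

section CMThree

variable (L : Type) [Field L] [NumberField L] [IsCMField L]
  (μ : Measure (quasiSplit (↥(maximalRealSubfield L)) L (IsCMField.complexConj L) 3).automorphicQuotient) [(quasiSplit (↥(maximalRealSubfield L)) L (IsCMField.complexConj L) 3).IsAutomorphicMeasure μ]
  {A M Λ : Type*} [AddCommGroup A] [Module ℂ A] [AddCommGroup M] [Module ℂ M] [AddCommGroup Λ] [Module ℂ Λ]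

/-- **(L₃), MEMBERSHIP FORM, any block `Sc`**: the model letter plus `eTop k ∈ ⨆_ψ ℂ·[ψ∘det]` and `eMid k ∈ resGMidAtom L μ ξ μω K″ ω″` for some `ξ` and SOME level `(K″, ω″)` give
`Sc ⊓ ker (snd ∘ U) ≤ (⨆_ψ ℂ·[ψ∘det]) ⊔ ⨆_ξ (resGMidBlock L μ ξ μω)` (★ `resGMidAtom_le_resGMidBlock`). [cite: Rogawski1990, §13.9 p. 229] [cite: MoeglinWaldspurger1995, V.3.13, VI.2] -/
theorem inf_ker_snd_le_lines_sup_midBlocks_of_mem (U : (quasiSplit (↥(maximalRealSubfield L)) L (IsCMField.complexConj L) 3).L2 μ →ₗ[ℂ] (A × M) × Λ) (Sc : Submodule ℂ ((quasiSplit (↥(maximalRealSubfield L)) L (IsCMField.complexConj L) 3).L2 μ)) (μω : HeckeCharacter L)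
    {ιt ιm : Type*} (eTop : ιt → (quasiSplit (↥(maximalRealSubfield L)) L (IsCMField.complexConj L) 3).L2 μ) (eMid : ιm → (quasiSplit (↥(maximalRealSubfield L)) L (IsCMField.complexConj L) 3).L2 μ)
    (hatom : ∀ v ∈ Sc, (U v).2 = 0 → v ∈ Submodule.span ℂ (Set.range eTop) ⊔ Submodule.span ℂ (Set.range eMid))
    (heTop : ∀ k, eTop k ∈ (⨆ ψ : {ψ : ↥(TorusDict.torus (IsCMField.complexConj L)) →ₜ* ℂˣ // TorusDict.IsAutomorphic (IsCMField.complexConj L) ψ},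
        (AdelicGroupData.AutomorphicCharacter.lineSubrep (𝒢 := (quasiSplit (↥(maximalRealSubfield L)) L (IsCMField.complexConj L) 3))
          (cmDetChar L 3 ((StdForm.antidiagonal 3).over L) ψ.1 ψ.2 ((Matrix.isUnit_iff_isUnit_det _).mp (StdForm.isUnit_over (StdForm.antidiagonal 3) L)).ne_zero) μ).toSubmodule))
    (heMid : ∀ k, ∃ (ξ : OneDimAutRepH L) (K'' : Subgroup (quasiSplit (↥(maximalRealSubfield L)) L (IsCMField.complexConj L) 3).Adelic) (ω'' : ↥K'' →* ℂ), eMid k ∈ resGMidAtom L μ ξ μω K'' ω'') :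
    Sc ⊓ LinearMap.ker ((LinearMap.snd ℂ (A × M) Λ).comp U) ≤ (⨆ ψ : {ψ : ↥(TorusDict.torus (IsCMField.complexConj L)) →ₜ* ℂˣ // TorusDict.IsAutomorphic (IsCMField.complexConj L) ψ},
        (AdelicGroupData.AutomorphicCharacter.lineSubrep (𝒢 := (quasiSplit (↥(maximalRealSubfield L)) L (IsCMField.complexConj L) 3))
          (cmDetChar L 3 ((StdForm.antidiagonal 3).over L) ψ.1 ψ.2 ((Matrix.isUnit_iff_isUnit_det _).mp (StdForm.isUnit_over (StdForm.antidiagonal 3) L)).ne_zero) μ).toSubmodule) ⊔ ⨆ ξ : OneDimAutRepH L, (resGMidBlock L μ ξ μω).toSubmodule := by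
  refine inf_ker_snd_le_sup_of_atoms_mem U Sc eTop eMid hatom _ _ heTop fun k => ?_
  obtain ⟨ξ, K'', ω'', hk⟩ := heMid k
  exact Submodule.mem_iSup_of_mem ξ (resGMidAtom_le_resGMidBlock L μ ξ μω K'' ω'' hk)

/-- **(L₃), A.E. ∕ GENERATOR FORM, any block `Sc`**: the model letter plus, per top residue class, an automorphic character `Θ` of `U(J₃)(𝔸)` and a scalar `r` with `⇑(eTop k) =ᵐ x ↦ r·Θ((out x)⁻¹)`
(★ F6's currency: the top-pole residue of the block is `r·(ψ∘det)`, `r = 0` off the self-dual packets) and, per middle residue class, the GENERATOR property `eMid k ∈ resGMidAtomGen L μ ξ μω K″ ω″`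
(it IS a pole-letter value at `z₀ = 3/2` of a continued Eisenstein family of a section of the `φ_ξ`-block) give `Sc ⊓ ker (snd ∘ U) ≤ (⨆_ψ ℂ·[ψ∘det]) ⊔ ⨆_ξ (resGMidBlock L μ ξ μω)`
(★ `mem_iSup_lineSubrep_cmDetChar_three_of_ae_eq`, ★ `mem_resGMidAtom_of_mem_gen`). [cite: Rogawski1990, §13.9 p. 229, §13.3 p. 202] [cite: MoeglinWaldspurger1995, IV.1.11, V.3.13] -/
theorem inf_ker_snd_le_lines_sup_midBlocks_of_ae_eq (U : (quasiSplit (↥(maximalRealSubfield L)) L (IsCMField.complexConj L) 3).L2 μ →ₗ[ℂ] (A × M) × Λ) (Sc : Submodule ℂ ((quasiSplit (↥(maximalRealSubfield L)) L (IsCMField.complexConj L) 3).L2 μ)) (μω : HeckeCharacter L)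
    {ιt ιm : Type*} (eTop : ιt → (quasiSplit (↥(maximalRealSubfield L)) L (IsCMField.complexConj L) 3).L2 μ) (eMid : ιm → (quasiSplit (↥(maximalRealSubfield L)) L (IsCMField.complexConj L) 3).L2 μ)
    (hatom : ∀ v ∈ Sc, (U v).2 = 0 → v ∈ Submodule.span ℂ (Set.range eTop) ⊔ Submodule.span ℂ (Set.range eMid))
    (heTop : ∀ k, ∃ (Θ : (quasiSplit (↥(maximalRealSubfield L)) L (IsCMField.complexConj L) 3).AutomorphicCharacter) (r : ℂ), ((eTop k : (quasiSplit (↥(maximalRealSubfield L)) L (IsCMField.complexConj L) 3).L2 μ) : (quasiSplit (↥(maximalRealSubfield L)) L (IsCMField.complexConj L) 3).automorphicQuotient → ℂ) =ᵐ[μ]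
        fun x => r * ((Θ (Quotient.out (x : (quasiSplit (↥(maximalRealSubfield L)) L (IsCMField.complexConj L) 3).Adelic ⧸ (quasiSplit (↥(maximalRealSubfield L)) L (IsCMField.complexConj L) 3).quotientSubgroup))⁻¹ : ℂˣ) : ℂ))
    (heMid : ∀ k, ∃ (ξ : OneDimAutRepH L) (K'' : Subgroup (quasiSplit (↥(maximalRealSubfield L)) L (IsCMField.complexConj L) 3).Adelic) (ω'' : ↥K'' →* ℂ), eMid k ∈ resGMidAtomGen L μ ξ μω K'' ω'') :
    Sc ⊓ LinearMap.ker ((LinearMap.snd ℂ (A × M) Λ).comp U) ≤ (⨆ ψ : {ψ : ↥(TorusDict.torus (IsCMField.complexConj L)) →ₜ* ℂˣ // TorusDict.IsAutomorphic (IsCMField.complexConj L) ψ},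
        (AdelicGroupData.AutomorphicCharacter.lineSubrep (𝒢 := (quasiSplit (↥(maximalRealSubfield L)) L (IsCMField.complexConj L) 3))
          (cmDetChar L 3 ((StdForm.antidiagonal 3).over L) ψ.1 ψ.2 ((Matrix.isUnit_iff_isUnit_det _).mp (StdForm.isUnit_over (StdForm.antidiagonal 3) L)).ne_zero) μ).toSubmodule) ⊔ ⨆ ξ : OneDimAutRepH L, (resGMidBlock L μ ξ μω).toSubmodule := by
  refine inf_ker_snd_le_lines_sup_midBlocks_of_mem L μ U Sc μω eTop eMid hatom (fun k => ?_) fun k => ?_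
  · obtain ⟨Θ, r, h⟩ := heTop k
    exact mem_iSup_lineSubrep_cmDetChar_three_of_ae_eq L μ Θ r h
  · obtain ⟨ξ, K'', ω'', hk⟩ := heMid k
    exact ⟨ξ, K'', ω'', mem_resGMidAtom_of_mem_gen L μ ξ μω K'' ω'' hk⟩

/-- **(L₃), POINTWISE-RESIDUE FORM, any block `Sc`**: as `_of_ae_eq`, with the top letter in T2-FINAL's shape `∀ g, F g = r·Θ g` plus `⇑(eTop k) =ᵐ x ↦ F((out x)⁻¹)`
(★ `mem_iSup_lineSubrep_cmDetChar_three_of_ae_eq_residue`). [cite: Rogawski1990, §13.9 p. 229, §13.3 p. 202] [cite: MoeglinWaldspurger1995, IV.1.11, V.3.13] -/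
theorem inf_ker_snd_le_lines_sup_midBlocks_of_residue (U : (quasiSplit (↥(maximalRealSubfield L)) L (IsCMField.complexConj L) 3).L2 μ →ₗ[ℂ] (A × M) × Λ) (Sc : Submodule ℂ ((quasiSplit (↥(maximalRealSubfield L)) L (IsCMField.complexConj L) 3).L2 μ)) (μω : HeckeCharacter L)
    {ιt ιm : Type*} (eTop : ιt → (quasiSplit (↥(maximalRealSubfield L)) L (IsCMField.complexConj L) 3).L2 μ) (eMid : ιm → (quasiSplit (↥(maximalRealSubfield L)) L (IsCMField.complexConj L) 3).L2 μ)
    (hatom : ∀ v ∈ Sc, (U v).2 = 0 → v ∈ Submodule.span ℂ (Set.range eTop) ⊔ Submodule.span ℂ (Set.range eMid))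
    (heTop : ∀ k, ∃ (Θ : (quasiSplit (↥(maximalRealSubfield L)) L (IsCMField.complexConj L) 3).AutomorphicCharacter) (F : (quasiSplit (↥(maximalRealSubfield L)) L (IsCMField.complexConj L) 3).Adelic → ℂ) (r : ℂ), (∀ g, F g = r * ((Θ g : ℂˣ) : ℂ)) ∧
      ((eTop k : (quasiSplit (↥(maximalRealSubfield L)) L (IsCMField.complexConj L) 3).L2 μ) : (quasiSplit (↥(maximalRealSubfield L)) L (IsCMField.complexConj L) 3).automorphicQuotient → ℂ) =ᵐ[μ]
        fun x => F (Quotient.out (x : (quasiSplit (↥(maximalRealSubfield L)) L (IsCMField.complexConj L) 3).Adelic ⧸ (quasiSplit (↥(maximalRealSubfield L)) L (IsCMField.complexConj L) 3).quotientSubgroup))⁻¹)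
    (heMid : ∀ k, ∃ (ξ : OneDimAutRepH L) (K'' : Subgroup (quasiSplit (↥(maximalRealSubfield L)) L (IsCMField.complexConj L) 3).Adelic) (ω'' : ↥K'' →* ℂ), eMid k ∈ resGMidAtomGen L μ ξ μω K'' ω'') :
    Sc ⊓ LinearMap.ker ((LinearMap.snd ℂ (A × M) Λ).comp U) ≤ (⨆ ψ : {ψ : ↥(TorusDict.torus (IsCMField.complexConj L)) →ₜ* ℂˣ // TorusDict.IsAutomorphic (IsCMField.complexConj L) ψ},
        (AdelicGroupData.AutomorphicCharacter.lineSubrep (𝒢 := (quasiSplit (↥(maximalRealSubfield L)) L (IsCMField.complexConj L) 3))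
          (cmDetChar L 3 ((StdForm.antidiagonal 3).over L) ψ.1 ψ.2 ((Matrix.isUnit_iff_isUnit_det _).mp (StdForm.isUnit_over (StdForm.antidiagonal 3) L)).ne_zero) μ).toSubmodule) ⊔ ⨆ ξ : OneDimAutRepH L, (resGMidBlock L μ ξ μω).toSubmodule := by
  refine inf_ker_snd_le_lines_sup_midBlocks_of_mem L μ U Sc μω eTop eMid hatom (fun k => ?_) fun k => ?_
  · obtain ⟨Θ, F, r, hres, h⟩ := heTop k
    exact mem_iSup_lineSubrep_cmDetChar_three_of_ae_eq_residue L μ Θ hres h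
  · obtain ⟨ξ, K'', ω'', hk⟩ := heMid k
    exact ⟨ξ, K'', ω'', mem_resGMidAtom_of_mem_gen L μ ξ μω K'' ω'' hk⟩

/-! ## §3 BY NAME at the ★ G-DEFS atoms `resGAtom L μ U K' ω χ₁ χ₂` and the ★ K-type atoms `resGAtomK L μ Iso U Kf χ₁ χ₂` -/

/-- **(L₃) BY NAME, MEMBERSHIP FORM**: `resGAtom L μ U K' ω χ₁ χ₂ ≤ (⨆_ψ ℂ·[ψ∘det]) ⊔ ⨆_ξ (resGMidBlock L μ ξ μω)` from the model letter over the block `resGBlock L μ K' ω χ₁ χ₂` and the two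
per-atom memberships (★ G-DEFS `resGAtom := resGBlock ⊓ ker (snd ∘ U)`). [cite: Rogawski1990, §13.9 p. 229] [cite: MoeglinWaldspurger1995, V.3.13, VI.2] -/
theorem resGAtom_le_lines_sup_midBlocks_of_mem (U : (quasiSplit (↥(maximalRealSubfield L)) L (IsCMField.complexConj L) 3).L2 μ →ₗ[ℂ] (A × M) × Λ)
    (K' : Subgroup (quasiSplit (↥(maximalRealSubfield L)) L (IsCMField.complexConj L) 3).Adelic) (ω : ↥K' →* ℂ) (χ₁ : HeckeCharacter L) (χ₂ : ↥(TorusDict.torus (IsCMField.complexConj L)) →ₜ* ℂˣ) (μω : HeckeCharacter L)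
    {ιt ιm : Type*} (eTop : ιt → (quasiSplit (↥(maximalRealSubfield L)) L (IsCMField.complexConj L) 3).L2 μ) (eMid : ιm → (quasiSplit (↥(maximalRealSubfield L)) L (IsCMField.complexConj L) 3).L2 μ)
    (hatom : ∀ v ∈ resGBlock L μ K' ω χ₁ χ₂, (U v).2 = 0 → v ∈ Submodule.span ℂ (Set.range eTop) ⊔ Submodule.span ℂ (Set.range eMid))
    (heTop : ∀ k, eTop k ∈ (⨆ ψ : {ψ : ↥(TorusDict.torus (IsCMField.complexConj L)) →ₜ* ℂˣ // TorusDict.IsAutomorphic (IsCMField.complexConj L) ψ},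
        (AdelicGroupData.AutomorphicCharacter.lineSubrep (𝒢 := (quasiSplit (↥(maximalRealSubfield L)) L (IsCMField.complexConj L) 3))
          (cmDetChar L 3 ((StdForm.antidiagonal 3).over L) ψ.1 ψ.2 ((Matrix.isUnit_iff_isUnit_det _).mp (StdForm.isUnit_over (StdForm.antidiagonal 3) L)).ne_zero) μ).toSubmodule))
    (heMid : ∀ k, ∃ (ξ : OneDimAutRepH L) (K'' : Subgroup (quasiSplit (↥(maximalRealSubfield L)) L (IsCMField.complexConj L) 3).Adelic) (ω'' : ↥K'' →* ℂ), eMid k ∈ resGMidAtom L μ ξ μω K'' ω'') :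
    resGAtom L μ U K' ω χ₁ χ₂ ≤ (⨆ ψ : {ψ : ↥(TorusDict.torus (IsCMField.complexConj L)) →ₜ* ℂˣ // TorusDict.IsAutomorphic (IsCMField.complexConj L) ψ},
        (AdelicGroupData.AutomorphicCharacter.lineSubrep (𝒢 := (quasiSplit (↥(maximalRealSubfield L)) L (IsCMField.complexConj L) 3))
          (cmDetChar L 3 ((StdForm.antidiagonal 3).over L) ψ.1 ψ.2 ((Matrix.isUnit_iff_isUnit_det _).mp (StdForm.isUnit_over (StdForm.antidiagonal 3) L)).ne_zero) μ).toSubmodule) ⊔ ⨆ ξ : OneDimAutRepH L, (resGMidBlock L μ ξ μω).toSubmodule :=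
  inf_ker_snd_le_lines_sup_midBlocks_of_mem L μ U (resGBlock L μ K' ω χ₁ χ₂) μω eTop eMid hatom heTop heMid

/-- **(L₃) BY NAME, A.E. ∕ GENERATOR FORM**: `resGAtom L μ U K' ω χ₁ χ₂ ≤ (⨆_ψ ℂ·[ψ∘det]) ⊔ ⨆_ξ (resGMidBlock L μ ξ μω)` from the model letter, the a.e. top letter `⇑(eTop k) =ᵐ x ↦ r·Θ((out x)⁻¹)`
and the middle generator letter `eMid k ∈ resGMidAtomGen L μ ξ μω K″ ω″`. [cite: Rogawski1990, §13.9 p. 229, §13.3 p. 202] [cite: MoeglinWaldspurger1995, IV.1.11, V.3.13] -/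
theorem resGAtom_le_lines_sup_midBlocks_of_ae_eq (U : (quasiSplit (↥(maximalRealSubfield L)) L (IsCMField.complexConj L) 3).L2 μ →ₗ[ℂ] (A × M) × Λ)
    (K' : Subgroup (quasiSplit (↥(maximalRealSubfield L)) L (IsCMField.complexConj L) 3).Adelic) (ω : ↥K' →* ℂ) (χ₁ : HeckeCharacter L) (χ₂ : ↥(TorusDict.torus (IsCMField.complexConj L)) →ₜ* ℂˣ) (μω : HeckeCharacter L)
    {ιt ιm : Type*} (eTop : ιt → (quasiSplit (↥(maximalRealSubfield L)) L (IsCMField.complexConj L) 3).L2 μ) (eMid : ιm → (quasiSplit (↥(maximalRealSubfield L)) L (IsCMField.complexConj L) 3).L2 μ)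
    (hatom : ∀ v ∈ resGBlock L μ K' ω χ₁ χ₂, (U v).2 = 0 → v ∈ Submodule.span ℂ (Set.range eTop) ⊔ Submodule.span ℂ (Set.range eMid))
    (heTop : ∀ k, ∃ (Θ : (quasiSplit (↥(maximalRealSubfield L)) L (IsCMField.complexConj L) 3).AutomorphicCharacter) (r : ℂ), ((eTop k : (quasiSplit (↥(maximalRealSubfield L)) L (IsCMField.complexConj L) 3).L2 μ) : (quasiSplit (↥(maximalRealSubfield L)) L (IsCMField.complexConj L) 3).automorphicQuotient → ℂ) =ᵐ[μ]
        fun x => r * ((Θ (Quotient.out (x : (quasiSplit (↥(maximalRealSubfield L)) L (IsCMField.complexConj L) 3).Adelic ⧸ (quasiSplit (↥(maximalRealSubfield L)) L (IsCMField.complexConj L) 3).quotientSubgroup))⁻¹ : ℂˣ) : ℂ))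
    (heMid : ∀ k, ∃ (ξ : OneDimAutRepH L) (K'' : Subgroup (quasiSplit (↥(maximalRealSubfield L)) L (IsCMField.complexConj L) 3).Adelic) (ω'' : ↥K'' →* ℂ), eMid k ∈ resGMidAtomGen L μ ξ μω K'' ω'') :
    resGAtom L μ U K' ω χ₁ χ₂ ≤ (⨆ ψ : {ψ : ↥(TorusDict.torus (IsCMField.complexConj L)) →ₜ* ℂˣ // TorusDict.IsAutomorphic (IsCMField.complexConj L) ψ},
        (AdelicGroupData.AutomorphicCharacter.lineSubrep (𝒢 := (quasiSplit (↥(maximalRealSubfield L)) L (IsCMField.complexConj L) 3))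
          (cmDetChar L 3 ((StdForm.antidiagonal 3).over L) ψ.1 ψ.2 ((Matrix.isUnit_iff_isUnit_det _).mp (StdForm.isUnit_over (StdForm.antidiagonal 3) L)).ne_zero) μ).toSubmodule) ⊔ ⨆ ξ : OneDimAutRepH L, (resGMidBlock L μ ξ μω).toSubmodule :=
  inf_ker_snd_le_lines_sup_midBlocks_of_ae_eq L μ U (resGBlock L μ K' ω χ₁ χ₂) μω eTop eMid hatom heTop heMid

/-- **(L₃) BY NAME, POINTWISE-RESIDUE FORM**: `resGAtom L μ U K' ω χ₁ χ₂ ≤ (⨆_ψ ℂ·[ψ∘det]) ⊔ ⨆_ξ (resGMidBlock L μ ξ μω)` from the model letter, the top letter `∀ g, F g = r·Θ g` with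
`⇑(eTop k) =ᵐ x ↦ F((out x)⁻¹)`, and the middle generator letter. [cite: Rogawski1990, §13.9 p. 229, §13.3 p. 202] [cite: MoeglinWaldspurger1995, IV.1.11, V.3.13] -/
theorem resGAtom_le_lines_sup_midBlocks_of_residue (U : (quasiSplit (↥(maximalRealSubfield L)) L (IsCMField.complexConj L) 3).L2 μ →ₗ[ℂ] (A × M) × Λ)
    (K' : Subgroup (quasiSplit (↥(maximalRealSubfield L)) L (IsCMField.complexConj L) 3).Adelic) (ω : ↥K' →* ℂ) (χ₁ : HeckeCharacter L) (χ₂ : ↥(TorusDict.torus (IsCMField.complexConj L)) →ₜ* ℂˣ) (μω : HeckeCharacter L)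
    {ιt ιm : Type*} (eTop : ιt → (quasiSplit (↥(maximalRealSubfield L)) L (IsCMField.complexConj L) 3).L2 μ) (eMid : ιm → (quasiSplit (↥(maximalRealSubfield L)) L (IsCMField.complexConj L) 3).L2 μ)
    (hatom : ∀ v ∈ resGBlock L μ K' ω χ₁ χ₂, (U v).2 = 0 → v ∈ Submodule.span ℂ (Set.range eTop) ⊔ Submodule.span ℂ (Set.range eMid))
    (heTop : ∀ k, ∃ (Θ : (quasiSplit (↥(maximalRealSubfield L)) L (IsCMField.complexConj L) 3).AutomorphicCharacter) (F : (quasiSplit (↥(maximalRealSubfield L)) L (IsCMField.complexConj L) 3).Adelic → ℂ) (r : ℂ), (∀ g, F g = r * ((Θ g : ℂˣ) : ℂ)) ∧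
      ((eTop k : (quasiSplit (↥(maximalRealSubfield L)) L (IsCMField.complexConj L) 3).L2 μ) : (quasiSplit (↥(maximalRealSubfield L)) L (IsCMField.complexConj L) 3).automorphicQuotient → ℂ) =ᵐ[μ]
        fun x => F (Quotient.out (x : (quasiSplit (↥(maximalRealSubfield L)) L (IsCMField.complexConj L) 3).Adelic ⧸ (quasiSplit (↥(maximalRealSubfield L)) L (IsCMField.complexConj L) 3).quotientSubgroup))⁻¹)
    (heMid : ∀ k, ∃ (ξ : OneDimAutRepH L) (K'' : Subgroup (quasiSplit (↥(maximalRealSubfield L)) L (IsCMField.complexConj L) 3).Adelic) (ω'' : ↥K'' →* ℂ), eMid k ∈ resGMidAtomGen L μ ξ μω K'' ω'') :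
    resGAtom L μ U K' ω χ₁ χ₂ ≤ (⨆ ψ : {ψ : ↥(TorusDict.torus (IsCMField.complexConj L)) →ₜ* ℂˣ // TorusDict.IsAutomorphic (IsCMField.complexConj L) ψ},
        (AdelicGroupData.AutomorphicCharacter.lineSubrep (𝒢 := (quasiSplit (↥(maximalRealSubfield L)) L (IsCMField.complexConj L) 3))
          (cmDetChar L 3 ((StdForm.antidiagonal 3).over L) ψ.1 ψ.2 ((Matrix.isUnit_iff_isUnit_det _).mp (StdForm.isUnit_over (StdForm.antidiagonal 3) L)).ne_zero) μ).toSubmodule) ⊔ ⨆ ξ : OneDimAutRepH L, (resGMidBlock L μ ξ μω).toSubmodule :=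
  inf_ker_snd_le_lines_sup_midBlocks_of_residue L μ U (resGBlock L μ K' ω χ₁ χ₂) μω eTop eMid hatom heTop heMid

/-- **(L₃) AT THE K-TYPE ATOMS OF RECORD, MEMBERSHIP FORM**: `resGAtomK L μ Iso U Kf χ₁ χ₂ = resGAtom L μ U (Kf.map ι_f) 1 χ₁ χ₂ ⊓ Iso` (★ p862819), so the letters at the finite level
`(Kf.map ι_f, 1)` suffice and `Iso` plays no role (★ `resGAtomK_le_resGAtom`). [cite: Rogawski1990, §13.9 p. 229] [cite: MoeglinWaldspurger1995, V.3.13, VI.2] -/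
theorem resGAtomK_le_lines_sup_midBlocks_of_mem (Iso : Submodule ℂ ((quasiSplit (↥(maximalRealSubfield L)) L (IsCMField.complexConj L) 3).L2 μ)) (U : (quasiSplit (↥(maximalRealSubfield L)) L (IsCMField.complexConj L) 3).L2 μ →ₗ[ℂ] (A × M) × Λ)
    (Kf : Subgroup ↥(finAdelic (↥(maximalRealSubfield L)) L (IsCMField.complexConj L) 3 ((StdForm.antidiagonal 3).over L))) (χ₁ : HeckeCharacter L) (χ₂ : ↥(TorusDict.torus (IsCMField.complexConj L)) →ₜ* ℂˣ) (μω : HeckeCharacter L)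
    {ιt ιm : Type*} (eTop : ιt → (quasiSplit (↥(maximalRealSubfield L)) L (IsCMField.complexConj L) 3).L2 μ) (eMid : ιm → (quasiSplit (↥(maximalRealSubfield L)) L (IsCMField.complexConj L) 3).L2 μ)
    (hatom : ∀ v ∈ resGBlock L μ (Kf.map (finAdelicToAdelic (↥(maximalRealSubfield L)) L (IsCMField.complexConj L) 3 ((StdForm.antidiagonal 3).over L))) 1 χ₁ χ₂, (U v).2 = 0 → v ∈ Submodule.span ℂ (Set.range eTop) ⊔ Submodule.span ℂ (Set.range eMid))
    (heTop : ∀ k, eTop k ∈ (⨆ ψ : {ψ : ↥(TorusDict.torus (IsCMField.complexConj L)) →ₜ* ℂˣ // TorusDict.IsAutomorphic (IsCMField.complexConj L) ψ},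
        (AdelicGroupData.AutomorphicCharacter.lineSubrep (𝒢 := (quasiSplit (↥(maximalRealSubfield L)) L (IsCMField.complexConj L) 3))
          (cmDetChar L 3 ((StdForm.antidiagonal 3).over L) ψ.1 ψ.2 ((Matrix.isUnit_iff_isUnit_det _).mp (StdForm.isUnit_over (StdForm.antidiagonal 3) L)).ne_zero) μ).toSubmodule))
    (heMid : ∀ k, ∃ (ξ : OneDimAutRepH L) (K'' : Subgroup (quasiSplit (↥(maximalRealSubfield L)) L (IsCMField.complexConj L) 3).Adelic) (ω'' : ↥K'' →* ℂ), eMid k ∈ resGMidAtom L μ ξ μω K'' ω'') :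
    resGAtomK L μ Iso U Kf χ₁ χ₂ ≤ (⨆ ψ : {ψ : ↥(TorusDict.torus (IsCMField.complexConj L)) →ₜ* ℂˣ // TorusDict.IsAutomorphic (IsCMField.complexConj L) ψ},
        (AdelicGroupData.AutomorphicCharacter.lineSubrep (𝒢 := (quasiSplit (↥(maximalRealSubfield L)) L (IsCMField.complexConj L) 3))
          (cmDetChar L 3 ((StdForm.antidiagonal 3).over L) ψ.1 ψ.2 ((Matrix.isUnit_iff_isUnit_det _).mp (StdForm.isUnit_over (StdForm.antidiagonal 3) L)).ne_zero) μ).toSubmodule) ⊔ ⨆ ξ : OneDimAutRepH L, (resGMidBlock L μ ξ μω).toSubmodule :=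
  (resGAtomK_le_resGAtom L μ Iso U Kf χ₁ χ₂).trans (resGAtom_le_lines_sup_midBlocks_of_mem L μ U _ 1 χ₁ χ₂ μω eTop eMid hatom heTop heMid)

/-- **(L₃) AT THE K-TYPE ATOMS OF RECORD, A.E. ∕ GENERATOR FORM**: the model letter at the finite level `(Kf.map ι_f, 1)`, the a.e. top letter `⇑(eTop k) =ᵐ x ↦ r·Θ((out x)⁻¹)` and the
middle generator letter give `resGAtomK L μ Iso U Kf χ₁ χ₂ ≤ (⨆_ψ ℂ·[ψ∘det]) ⊔ ⨆_ξ (resGMidBlock L μ ξ μω)`. [cite: Rogawski1990, §13.9 p. 229, §13.3 p. 202] [cite: MoeglinWaldspurger1995, IV.1.11, V.3.13] -/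
theorem resGAtomK_le_lines_sup_midBlocks_of_ae_eq (Iso : Submodule ℂ ((quasiSplit (↥(maximalRealSubfield L)) L (IsCMField.complexConj L) 3).L2 μ)) (U : (quasiSplit (↥(maximalRealSubfield L)) L (IsCMField.complexConj L) 3).L2 μ →ₗ[ℂ] (A × M) × Λ)
    (Kf : Subgroup ↥(finAdelic (↥(maximalRealSubfield L)) L (IsCMField.complexConj L) 3 ((StdForm.antidiagonal 3).over L))) (χ₁ : HeckeCharacter L) (χ₂ : ↥(TorusDict.torus (IsCMField.complexConj L)) →ₜ* ℂˣ) (μω : HeckeCharacter L)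
    {ιt ιm : Type*} (eTop : ιt → (quasiSplit (↥(maximalRealSubfield L)) L (IsCMField.complexConj L) 3).L2 μ) (eMid : ιm → (quasiSplit (↥(maximalRealSubfield L)) L (IsCMField.complexConj L) 3).L2 μ)
    (hatom : ∀ v ∈ resGBlock L μ (Kf.map (finAdelicToAdelic (↥(maximalRealSubfield L)) L (IsCMField.complexConj L) 3 ((StdForm.antidiagonal 3).over L))) 1 χ₁ χ₂, (U v).2 = 0 → v ∈ Submodule.span ℂ (Set.range eTop) ⊔ Submodule.span ℂ (Set.range eMid))
    (heTop : ∀ k, ∃ (Θ : (quasiSplit (↥(maximalRealSubfield L)) L (IsCMField.complexConj L) 3).AutomorphicCharacter) (r : ℂ), ((eTop k : (quasiSplit (↥(maximalRealSubfield L)) L (IsCMField.complexConj L) 3).L2 μ) : (quasiSplit (↥(maximalRealSubfield L)) L (IsCMField.complexConj L) 3).automorphicQuotient → ℂ) =ᵐ[μ]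
        fun x => r * ((Θ (Quotient.out (x : (quasiSplit (↥(maximalRealSubfield L)) L (IsCMField.complexConj L) 3).Adelic ⧸ (quasiSplit (↥(maximalRealSubfield L)) L (IsCMField.complexConj L) 3).quotientSubgroup))⁻¹ : ℂˣ) : ℂ))
    (heMid : ∀ k, ∃ (ξ : OneDimAutRepH L) (K'' : Subgroup (quasiSplit (↥(maximalRealSubfield L)) L (IsCMField.complexConj L) 3).Adelic) (ω'' : ↥K'' →* ℂ), eMid k ∈ resGMidAtomGen L μ ξ μω K'' ω'') :
    resGAtomK L μ Iso U Kf χ₁ χ₂ ≤ (⨆ ψ : {ψ : ↥(TorusDict.torus (IsCMField.complexConj L)) →ₜ* ℂˣ // TorusDict.IsAutomorphic (IsCMField.complexConj L) ψ},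
        (AdelicGroupData.AutomorphicCharacter.lineSubrep (𝒢 := (quasiSplit (↥(maximalRealSubfield L)) L (IsCMField.complexConj L) 3))
          (cmDetChar L 3 ((StdForm.antidiagonal 3).over L) ψ.1 ψ.2 ((Matrix.isUnit_iff_isUnit_det _).mp (StdForm.isUnit_over (StdForm.antidiagonal 3) L)).ne_zero) μ).toSubmodule) ⊔ ⨆ ξ : OneDimAutRepH L, (resGMidBlock L μ ξ μω).toSubmodule :=
  (resGAtomK_le_resGAtom L μ Iso U Kf χ₁ χ₂).trans (resGAtom_le_lines_sup_midBlocks_of_ae_eq L μ U _ 1 χ₁ χ₂ μω eTop eMid hatom heTop heMid)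

/-! ## §4 ★ F1_qs's `hL` binder shape over an index family, at `Bn := fun ξ => resGMidBlock L μ ξ μω` -/

/-- **THE LETTER `hL` OF ★ `residualG_le_topologicalClosure_of_letters_quasiSplit` AT THE K-TYPE ATOMS, MEMBERSHIP FORM**: for any index type `ι`, block index types `β i`, pieces `Iso i`,
finite levels `Kf i`, model maps `U i b`, block characters `(χ₁ i b, χ₂ i b)` and residue families `eTop i b`, `eMid i b` with the model letter and the two per-atom memberships:
`∀ i b, resGAtomK L μ (Iso i) (U i b) (Kf i) (χ₁ i b) (χ₂ i b) ≤ (⨆_ψ ℂ·[ψ∘det]) ⊔ ⨆_ξ (resGMidBlock L μ ξ μω)` — the `hL` binder with `At i b := resGAtomK …`, `Bn := fun ξ => resGMidBlock L μ ξ μω`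
(index of record: `Iso i := Fix(ι_f i.1.1) ⊓ N i`, `Kf i := i.1.1`, `χ⋆ i b := χ⋆ b`). [cite: Rogawski1990, §13.9 p. 229] [cite: MoeglinWaldspurger1995, V.3.13, VI.2] -/
theorem hL_kType_of_atoms_mem {ι : Type*} {β : ι → Type*} (Iso : ι → Submodule ℂ ((quasiSplit (↥(maximalRealSubfield L)) L (IsCMField.complexConj L) 3).L2 μ)) (Kf : ι → Subgroup ↥(finAdelic (↥(maximalRealSubfield L)) L (IsCMField.complexConj L) 3 ((StdForm.antidiagonal 3).over L)))
    {Aι Mι Λι : ∀ i, β i → Type*} [∀ i b, AddCommGroup (Aι i b)] [∀ i b, Module ℂ (Aι i b)] [∀ i b, AddCommGroup (Mι i b)] [∀ i b, Module ℂ (Mι i b)]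
    [∀ i b, AddCommGroup (Λι i b)] [∀ i b, Module ℂ (Λι i b)]
    (U : ∀ (i : ι) (b : β i), (quasiSplit (↥(maximalRealSubfield L)) L (IsCMField.complexConj L) 3).L2 μ →ₗ[ℂ] (Aι i b × Mι i b) × Λι i b)
    (χ₁ : ∀ i, β i → HeckeCharacter L) (χ₂ : ∀ i, β i → (↥(TorusDict.torus (IsCMField.complexConj L)) →ₜ* ℂˣ)) (μω : HeckeCharacter L)
    {ιt ιm : ∀ i, β i → Type*} (eTop : ∀ (i : ι) (b : β i), ιt i b → (quasiSplit (↥(maximalRealSubfield L)) L (IsCMField.complexConj L) 3).L2 μ) (eMid : ∀ (i : ι) (b : β i), ιm i b → (quasiSplit (↥(maximalRealSubfield L)) L (IsCMField.complexConj L) 3).L2 μ)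
    (hatom : ∀ (i : ι) (b : β i), ∀ v ∈ resGBlock L μ ((Kf i).map (finAdelicToAdelic (↥(maximalRealSubfield L)) L (IsCMField.complexConj L) 3 ((StdForm.antidiagonal 3).over L))) 1 (χ₁ i b) (χ₂ i b),
      (U i b v).2 = 0 → v ∈ Submodule.span ℂ (Set.range (eTop i b)) ⊔ Submodule.span ℂ (Set.range (eMid i b)))
    (heTop : ∀ (i : ι) (b : β i) (k : ιt i b), eTop i b k ∈ (⨆ ψ : {ψ : ↥(TorusDict.torus (IsCMField.complexConj L)) →ₜ* ℂˣ // TorusDict.IsAutomorphic (IsCMField.complexConj L) ψ},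
        (AdelicGroupData.AutomorphicCharacter.lineSubrep (𝒢 := (quasiSplit (↥(maximalRealSubfield L)) L (IsCMField.complexConj L) 3))
          (cmDetChar L 3 ((StdForm.antidiagonal 3).over L) ψ.1 ψ.2 ((Matrix.isUnit_iff_isUnit_det _).mp (StdForm.isUnit_over (StdForm.antidiagonal 3) L)).ne_zero) μ).toSubmodule))
    (heMid : ∀ (i : ι) (b : β i) (k : ιm i b), ∃ (ξ : OneDimAutRepH L) (K'' : Subgroup (quasiSplit (↥(maximalRealSubfield L)) L (IsCMField.complexConj L) 3).Adelic) (ω'' : ↥K'' →* ℂ), eMid i b k ∈ resGMidAtom L μ ξ μω K'' ω'') :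
    ∀ (i : ι) (b : β i), resGAtomK L μ (Iso i) (U i b) (Kf i) (χ₁ i b) (χ₂ i b) ≤ (⨆ ψ : {ψ : ↥(TorusDict.torus (IsCMField.complexConj L)) →ₜ* ℂˣ // TorusDict.IsAutomorphic (IsCMField.complexConj L) ψ},
        (AdelicGroupData.AutomorphicCharacter.lineSubrep (𝒢 := (quasiSplit (↥(maximalRealSubfield L)) L (IsCMField.complexConj L) 3))
          (cmDetChar L 3 ((StdForm.antidiagonal 3).over L) ψ.1 ψ.2 ((Matrix.isUnit_iff_isUnit_det _).mp (StdForm.isUnit_over (StdForm.antidiagonal 3) L)).ne_zero) μ).toSubmodule) ⊔ ⨆ ξ : OneDimAutRepH L, (resGMidBlock L μ ξ μω).toSubmodule :=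
  fun i b => resGAtomK_le_lines_sup_midBlocks_of_mem L μ (Iso i) (U i b) (Kf i) (χ₁ i b) (χ₂ i b) μω (eTop i b) (eMid i b) (hatom i b) (heTop i b) (heMid i b)

/-- **THE LETTER `hL` OF ★ `residualG_le_topologicalClosure_of_letters_quasiSplit` AT THE K-TYPE ATOMS, A.E. ∕ GENERATOR FORM**: as `hL_kType_of_atoms_mem`, with the top letter in ★ F6's
a.e. currency `⇑(eTop i b k) =ᵐ x ↦ r·Θ((out x)⁻¹)` and the middle letter as the generator property `eMid i b k ∈ resGMidAtomGen L μ ξ μω K″ ω″` (the shapes the (L₃-i)∕(L₃-ii) payers deliver).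
[cite: Rogawski1990, §13.9 p. 229, §13.3 p. 202] [cite: MoeglinWaldspurger1995, IV.1.11, V.3.13] -/
theorem hL_kType_of_atoms {ι : Type*} {β : ι → Type*} (Iso : ι → Submodule ℂ ((quasiSplit (↥(maximalRealSubfield L)) L (IsCMField.complexConj L) 3).L2 μ)) (Kf : ι → Subgroup ↥(finAdelic (↥(maximalRealSubfield L)) L (IsCMField.complexConj L) 3 ((StdForm.antidiagonal 3).over L)))
    {Aι Mι Λι : ∀ i, β i → Type*} [∀ i b, AddCommGroup (Aι i b)] [∀ i b, Module ℂ (Aι i b)] [∀ i b, AddCommGroup (Mι i b)] [∀ i b, Module ℂ (Mι i b)]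
    [∀ i b, AddCommGroup (Λι i b)] [∀ i b, Module ℂ (Λι i b)]
    (U : ∀ (i : ι) (b : β i), (quasiSplit (↥(maximalRealSubfield L)) L (IsCMField.complexConj L) 3).L2 μ →ₗ[ℂ] (Aι i b × Mι i b) × Λι i b)
    (χ₁ : ∀ i, β i → HeckeCharacter L) (χ₂ : ∀ i, β i → (↥(TorusDict.torus (IsCMField.complexConj L)) →ₜ* ℂˣ)) (μω : HeckeCharacter L)
    {ιt ιm : ∀ i, β i → Type*} (eTop : ∀ (i : ι) (b : β i), ιt i b → (quasiSplit (↥(maximalRealSubfield L)) L (IsCMField.complexConj L) 3).L2 μ) (eMid : ∀ (i : ι) (b : β i), ιm i b → (quasiSplit (↥(maximalRealSubfield L)) L (IsCMField.complexConj L) 3).L2 μ)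
    (hatom : ∀ (i : ι) (b : β i), ∀ v ∈ resGBlock L μ ((Kf i).map (finAdelicToAdelic (↥(maximalRealSubfield L)) L (IsCMField.complexConj L) 3 ((StdForm.antidiagonal 3).over L))) 1 (χ₁ i b) (χ₂ i b),
      (U i b v).2 = 0 → v ∈ Submodule.span ℂ (Set.range (eTop i b)) ⊔ Submodule.span ℂ (Set.range (eMid i b)))
    (heTop : ∀ (i : ι) (b : β i) (k : ιt i b), ∃ (Θ : (quasiSplit (↥(maximalRealSubfield L)) L (IsCMField.complexConj L) 3).AutomorphicCharacter) (r : ℂ), ((eTop i b k : (quasiSplit (↥(maximalRealSubfield L)) L (IsCMField.complexConj L) 3).L2 μ) : (quasiSplit (↥(maximalRealSubfield L)) L (IsCMField.complexConj L) 3).automorphicQuotient → ℂ) =ᵐ[μ]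
        fun x => r * ((Θ (Quotient.out (x : (quasiSplit (↥(maximalRealSubfield L)) L (IsCMField.complexConj L) 3).Adelic ⧸ (quasiSplit (↥(maximalRealSubfield L)) L (IsCMField.complexConj L) 3).quotientSubgroup))⁻¹ : ℂˣ) : ℂ))
    (heMid : ∀ (i : ι) (b : β i) (k : ιm i b), ∃ (ξ : OneDimAutRepH L) (K'' : Subgroup (quasiSplit (↥(maximalRealSubfield L)) L (IsCMField.complexConj L) 3).Adelic) (ω'' : ↥K'' →* ℂ), eMid i b k ∈ resGMidAtomGen L μ ξ μω K'' ω'') :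
    ∀ (i : ι) (b : β i), resGAtomK L μ (Iso i) (U i b) (Kf i) (χ₁ i b) (χ₂ i b) ≤ (⨆ ψ : {ψ : ↥(TorusDict.torus (IsCMField.complexConj L)) →ₜ* ℂˣ // TorusDict.IsAutomorphic (IsCMField.complexConj L) ψ},
        (AdelicGroupData.AutomorphicCharacter.lineSubrep (𝒢 := (quasiSplit (↥(maximalRealSubfield L)) L (IsCMField.complexConj L) 3))
          (cmDetChar L 3 ((StdForm.antidiagonal 3).over L) ψ.1 ψ.2 ((Matrix.isUnit_iff_isUnit_det _).mp (StdForm.isUnit_over (StdForm.antidiagonal 3) L)).ne_zero) μ).toSubmodule) ⊔ ⨆ ξ : OneDimAutRepH L, (resGMidBlock L μ ξ μω).toSubmodule :=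
  fun i b => resGAtomK_le_lines_sup_midBlocks_of_ae_eq L μ (Iso i) (U i b) (Kf i) (χ₁ i b) (χ₂ i b) μω (eTop i b) (eMid i b) (hatom i b) (heTop i b) (heMid i b)

end CMThree

end Summit.HodgeConjecture.HodgeConjecture.R90.S8

end
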